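import Summits.CriticalPhenomena.PercolationContinuityZ3.Theorems.PercNearOneGluingNoHeavyPcintChainMem
import Summits.CriticalPhenomena.PercolationContinuityZ3.Theorems.PercNearOneGluingNoHeavyPcintChordMemKernel
import HarnessLib

/-!
# PCINT lane, reduced-state B3c certificates (bond): the computable (kernel) layer — deterministic units

Cell `prim-pcint` (PAPER-2 track (iii)), seat `prim-pcint-2` (gen 4); support file (`--supports stmt-CriticalPhenomena-4575`).
Does NOT build on p205010.  Kernel-evaluable mirrors (natural-number and integer-list arithmetic only) of the deterministic
unit count `cdet` of `…PcintChainMem` on the kernel states `NawK.KState`: the det-paying letter test `BondK.cdetP` (mirror of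
membership in `cdetSet`), the bonus test `BondK.cbonusP` (mirror of `bcbonus`) and the unit count `BondK.cdetK`, with the
SOUNDNESS bridge `BondK.cdetK_le_cdet` (the kernel never over-charges: fewer units only make the certified weights larger).
The step `BondK.mstepK`, the chord count `BondK.bchordK` and the corner flag `BondK.bcornerK` of `…PcintChordMemKernel` are
reused verbatim.  Table format, row check and final assembly: `…PcintChainMemKernelCert`.
-/

namespace Summit.CriticalPhenomena.PercolationContinuityZ3.Theorems.Pcint

open Finset Literature.Probability.Percolation Literature.Probability.LatticeModels

namespace BondK

open WinK (toSite toL addL adjL toSite_addL toSite_toL adj_iff_adjL toSite_inj length_toL length_addL)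
open NawK (KState toM mem_toM WF length_of_WF letters mem_letters nodup_letters l1L)

variable {d : ℕ}

/-! ### The kernel unit count -/

/-- Kernel DET-PAYING test of the letter `b` (mirror of `w = e_a + e_b ∈ cdetSet`): the site is not the origin, is not
remembered, has a remembered incidence of age `≥ 2` and a remembered incidence of age `+ 1 ≤ kc`. [folklore] -/
def cdetP (d kc : ℕ) (L : KState) (a b : Fin d × Bool) : Bool :=
  !(l1L (addL (toL d a) (toL d b)) == 0) &&
    !(L.any fun q => decide (q.1 = addL (toL d a) (toL d b))) &&
    (L.any fun q => decide (2 ≤ q.2) && adjL d q.1 (addL (toL d a) (toL d b))) &&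
    (L.any fun q => decide (q.2 + 1 ≤ kc) && adjL d q.1 (addL (toL d a) (toL d b)))

/-- Kernel BONUS test at the list site `w` (mirror of `bcbonus`): some remembered incidence `q₁` is linked with
`age + kc + 3 ≤ τ`, and every other remembered incidence is older than `age(q₁) + kc`. [folklore] -/
def cbonusP (d τ kc : ℕ) (L : KState) (w : List ℤ) : Bool :=
  L.any fun q₁ => adjL d q₁.1 w && decide (q₁.2 + 1 ≤ kc) && decide (q₁.2 + kc + 3 ≤ τ) &&
    L.all fun q => !adjL d q.1 w || decide (q = q₁) || decide (q₁.2 + kc < q.2)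

/-- Kernel deterministic unit count (mirror of `cdet`): det-paying letters plus det-paying letters with bonus. [folklore] -/
def cdetK (d τ kc : ℕ) (L : KState) (a : Fin d × Bool) : ℕ :=
  ((letters d).filter fun b => cdetP d kc L a b).length +
    ((letters d).filter fun b => cdetP d kc L a b && cbonusP d τ kc L (addL (toL d a) (toL d b))).length

/-- The kernel unit count is at most `4d`. [folklore] -/
theorem cdetK_le (τ kc : ℕ) (L : KState) (a : Fin d × Bool) : cdetK d τ kc L a ≤ 4 * d := by
  unfold cdetK
  have h1 := (List.length_filter_le (fun b => cdetP d kc L a b) (letters d)).trans (le_of_eq NawK.length_letters)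
  have h2 := (List.length_filter_le (fun b => cdetP d kc L a b && cbonusP d τ kc L (addL (toL d a) (toL d b)))
    (letters d)).trans (le_of_eq NawK.length_letters)
  omega

/-! ### Soundness of the unit count -/

/-- **A kernel det-paying letter is a det-paying site.** [folklore] -/
theorem mem_cdetSet_of_cdetP {kc : ℕ} {L : KState} (hL : WF d L = true) {a b : Fin d × Bool}
    (h : cdetP d kc L a b = true) : stepVec a + stepVec b ∈ cdetSet kc (toM L : MState d) a := by
  classical
  unfold cdetP at h
  simp only [Bool.and_eq_true, List.any_eq_true, decide_eq_true_eq, Bool.not_eq_true'] at h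
  obtain ⟨⟨⟨h0, hnot⟩, x, hx, hx2, hadj⟩, y, hy, hyk, hadj'⟩ := h
  have hlen : (addL (toL d a) (toL d b)).length = d := length_addL (length_toL a) (length_toL b)
  have hsite : (toSite (addL (toL d a) (toL d b)) : Site d) = stepVec a + stepVec b := by
    rw [toSite_addL (length_toL a) (length_toL b), toSite_toL, toSite_toL]
  rw [cdetSet, Finset.mem_filter, mem_nbrSites]
  refine ⟨(zdGraph_adj_iff_stepVec _ _).2 ⟨b, rfl⟩, ?_, fun q hq hqe => ?_, ⟨(toSite x.1, x.2), ?_, hx2⟩,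
    ⟨(toSite y.1, y.2), ?_, hyk⟩⟩
  · show stepVec a + stepVec b ≠ 0
    rw [← hsite]
    refine toSite_ne_zero_of_l1L hlen ?_
    simpa using h0
  · obtain ⟨z, hz, rfl⟩ := mem_toM.1 hq
    have hzl := length_of_WF hL hz
    have : (L.any fun q => decide (q.1 = addL (toL d a) (toL d b))) = true := by
      rw [List.any_eq_true]
      refine ⟨z, hz, ?_⟩
      rw [decide_eq_true_eq]
      exact toSite_inj hzl hlen (by rw [hsite]; exact hqe)
    rw [this] at hnot
    exact Bool.noConfusion hnot
  · rw [mem_bcinc]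
    refine ⟨mem_toM.2 ⟨x, hx, rfl⟩, ?_⟩
    have := (adj_iff_adjL (length_of_WF hL hx) hlen).2 hadj
    rwa [hsite] at this
  · rw [mem_bcinc]
    refine ⟨mem_toM.2 ⟨y, hy, rfl⟩, ?_⟩
    have := (adj_iff_adjL (length_of_WF hL hy) hlen).2 hadj'
    rwa [hsite] at this

/-- **A kernel bonus is a bonus.** [folklore] -/
theorem bcbonus_of_cbonusP {τ kc : ℕ} {L : KState} (hL : WF d L = true) {w : List ℤ} (hw : w.length = d)
    (h : cbonusP d τ kc L w = true) : bcbonus τ kc (toM L : MState d) (toSite w) := by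
  unfold cbonusP at h
  rw [List.any_eq_true] at h
  obtain ⟨x, hx, h⟩ := h
  simp only [Bool.and_eq_true, decide_eq_true_eq, List.all_eq_true, Bool.or_eq_true, Bool.not_eq_true'] at h
  obtain ⟨⟨⟨hadj, hk⟩, hτ⟩, hall⟩ := h
  have hxl := length_of_WF hL hx
  refine ⟨(toSite x.1, x.2), mem_bcinc.2 ⟨mem_toM.2 ⟨x, hx, rfl⟩, (adj_iff_adjL hxl hw).2 hadj⟩, hk, hτ,
    fun q hq hne => ?_⟩
  obtain ⟨hqS, hqadj⟩ := mem_bcinc.1 hq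
  obtain ⟨y, hy, rfl⟩ := mem_toM.1 hqS
  have hyl := length_of_WF hL hy
  rcases hall y hy with (hna | rfl) | hlt
  · have h' : adjL d y.1 w = true := (adj_iff_adjL hyl hw).1 hqadj
    rw [h'] at hna
    exact Bool.noConfusion hna
  · exact absurd rfl hne
  · exact hlt

/-- **The kernel unit count does not exceed the deterministic unit count.** [folklore] -/
theorem cdetK_le_cdet {τ kc : ℕ} {L : KState} (hL : WF d L = true) (a : Fin d × Bool) :
    cdetK d τ kc L a ≤ cdet τ kc (toM L : MState d) a := by
  classical
  unfold cdetK cdet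
  have hsite : ∀ b : Fin d × Bool, (toSite (addL (toL d a) (toL d b)) : Site d) = stepVec a + stepVec b := fun b => by
    rw [toSite_addL (length_toL a) (length_toL b), toSite_toL, toSite_toL]
  refine add_le_add ?_ ?_
  · have hnd : ((letters d).filter fun b => cdetP d kc L a b).Nodup := nodup_letters.filter _
    rw [← List.toFinset_card_of_nodup hnd]
    refine Finset.card_le_card_of_injOn (fun b => stepVec a + stepVec b) (fun b hb => ?_)
      (fun b _ b' _ h => stepVec_add_injective a h)
    rw [Finset.mem_coe, List.mem_toFinset, List.mem_filter] at hb
    rw [Finset.mem_coe]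
    exact mem_cdetSet_of_cdetP hL hb.2
  · have hnd : ((letters d).filter fun b => cdetP d kc L a b && cbonusP d τ kc L (addL (toL d a) (toL d b))).Nodup :=
      nodup_letters.filter _
    rw [← List.toFinset_card_of_nodup hnd]
    refine Finset.card_le_card_of_injOn (fun b => stepVec a + stepVec b) (fun b hb => ?_)
      (fun b _ b' _ h => stepVec_add_injective a h)
    rw [Finset.mem_coe, List.mem_toFinset, List.mem_filter] at hb
    obtain ⟨-, hb⟩ := hb
    rw [Bool.and_eq_true] at hb
    rw [Finset.mem_coe, Finset.mem_filter]
    refine ⟨mem_cdetSet_of_cdetP hL hb.1, ?_⟩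
    have := bcbonus_of_cbonusP hL (length_addL (length_toL a) (length_toL b)) hb.2 (τ := τ) (kc := kc)
    rwa [hsite b] at this

end BondK

end Summit.CriticalPhenomena.PercolationContinuityZ3.Theorems.Pcint
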